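import Mathlib.RingTheory.Ideal.Basic
import Mathlib.Tactic.Ring

/-!
# Solo-informed: the 4-cycle product identity (finite core of Lemma 7.52(i))

In the chart normal form of a rank-3 bilinear family the labels are
`o_ij = v(a_i d_j + b_i + c_j)`.  If the four pairs of a 4-cycle `{i,i'} × {j,j'}` are all alive at
depth `t` (the four sums lie in the ideal `J = (z^t)`), then `(a_i - a_i') (d_j - d_j') ∈ J`, i.e.
`v(a_i - a_i') + v(d_j - d_j') ≥ t` in `ℂ[[z]]`.  We record the ring-theoretic core over an arbitrary
commutative ring, for an ideal and for divisibility by a fixed element.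
-/

namespace Summit.ValiantsHypothesis.ValiantsHypothesis.Theorems

/-- The alternating sum of `a d + b + c` around a 4-cycle is the product of differences. -/
theorem soloInformed_fourCycle_altSum {R : Type*} [CommRing R] (a a' b b' c c' d d' : R) :
    (a * d + b + c) - (a' * d + b' + c) - (a * d' + b + c') + (a' * d' + b' + c')
      = (a - a') * (d - d') := by
  ring

/-- Ideal form: four alive pairs of a 4-cycle force the product of differences into the ideal. -/
theorem soloInformed_fourCycle_product_mem {R : Type*} [CommRing R] (J : Ideal R)
    (a a' b b' c c' d d' : R)
    (h1 : a * d + b + c ∈ J) (h2 : a' * d + b' + c ∈ J)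
    (h3 : a * d' + b + c' ∈ J) (h4 : a' * d' + b' + c' ∈ J) :
    (a - a') * (d - d') ∈ J := by
  rw [← soloInformed_fourCycle_altSum]
  exact J.add_mem (J.sub_mem (J.sub_mem h1 h2) h3) h4

/-- Divisibility form (take `x = z`, so `x ^ t ∣ _` is "alive at depth `t`"). -/
theorem soloInformed_fourCycle_product_dvd {R : Type*} [CommRing R] (x : R) (t : ℕ)
    (a a' b b' c c' d d' : R)
    (h1 : x ^ t ∣ a * d + b + c) (h2 : x ^ t ∣ a' * d + b' + c)
    (h3 : x ^ t ∣ a * d' + b + c') (h4 : x ^ t ∣ a' * d' + b' + c') :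
    x ^ t ∣ (a - a') * (d - d') := by
  rw [← soloInformed_fourCycle_altSum]
  exact dvd_add (dvd_sub (dvd_sub h1 h2) h3) h4

/-- General cycles (Lemma 7.52(ii)), length 6: the alternating sum of the products is a
two-term combination of differences, hence lies in `J` when the six sums do. -/
theorem soloInformed_sixCycle_altSum {R : Type*} [CommRing R]
    (a₁ a₂ a₃ d₁ d₂ d₃ : R) :
    a₁ * d₁ - a₂ * d₁ + a₂ * d₂ - a₃ * d₂ + a₃ * d₃ - a₁ * d₃
      = (d₁ - d₃) * (a₁ - a₂) + (d₂ - d₃) * (a₂ - a₃) := by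
  ring

end Summit.ValiantsHypothesis.ValiantsHypothesis.Theorems
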